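import Summits.AtomisticToContinuum.FouriersLaw.Theses.EmbeddedDrudeMourre
import Summits.AtomisticToContinuum.FouriersLaw.Theorems.FGRGap.Negative.LoadBearing

/-!
# FGRGap / line log-coercive-compact-resolvent (cdisprove gen 3, cycle 2): the additive constant of
# log-coercivity is load-bearing; the quantitative inputs of STUB 1

Crux `EmbeddedDrudeMourre.FGRGap` (stmt-AtomisticToContinuum-12595), picked line
`Cruxes/FGRGap/Lines/log-coercive-compact-resolvent.lean`.  That line reaches compactness through the
log-Sobolev (Gagliardo) functional `G(f) = ∫_cell dk ∫_{(-1,1)} dt (f(k+t) - f(k))²/|t|` and the two estimates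
`c·Q_H ≤ q` (STUB 1) and `c·G ≤ Q_H + C‖f‖²` (STUB 2, hardest), `Q_H` the weight-free grazing functional of a
resonant partner map `H`.

This file records, kernel-checked and with the functionals written out (so that the statements are the
line's `gagliardoLog` / `grazingFunctional` after `unfold`), that the ADDITIVE CONSTANT `C` cannot be dropped:

* `not_logCoercive_without_C`: for every `ω₂ > 0` and every vertex `(a, b)` there is NO `c > 0` with
  `c·G(f) ≤ q(f)` for all periodic measurable `f ∈ L²` — witness the energy invariant `ω`
  (`q(ω) = 0`, `boltzmannForm_const_add_mul_dispersion`, while `G(ω) > 0`, `gagliardo_dispersion_pos`);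
* `no_grazingDecorrelation_without_C`: for every `ω₂ > 0`, `t₀` and EVERY a.e.-resonant partner map `H`
  (the resonance clause of the line's `IsGrazingBranch`) there is no `c > 0` with `c·G(f) ≤ Q_H(f)` for all
  such `f` — `Q_H(ω) = 0` because the bracket of `ω` along the branch IS the resonance function
  (`grazing_dispersion_eq_zero`).

So STUB 2 / `LogCoerciveAt` are genuinely inhomogeneous statements (low frequencies must be paid for by
`C‖f‖²`); the stubs as typed (with `C`) are NOT refuted — the cycle-2 numerics of `Cruxes/FGRGap/Disproof.lean`
§9 find them true fold-locally with marginal constant `c* ≈ 1` and `C ≈ 12–20`.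
Second part (helpers for STUB 1 `stub_grazingLowerBound`, conclusions about Literature objects only):
`vertex_ge_on_strip` (`Φ_{a,b}(k,H,k+t) ≥ a − bt²` for all real `k, H, t`, `b ≥ 0`), `resonanceJacobian_le`
(`|∂₂Ω(k₁,k₂,k₃)| ≤ L(ω₂)|k₃ − k₁|` for every `k₂`, `L = 1/√ω₂ + 1/√ω₂³`, mean value theorem),
`prod_dispersion_sq_le`, and the combined `collisionWeight_ge_on_strip`
(`w(k,H,k+t) ≥ (9/16π)(a/2)²(ω₂+4)⁻⁴/(L|t|)` when `bt² ≤ a/2` and the Jacobian is non-zero).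
-/

noncomputable section

open MeasureTheory Set Real Filter Topology
open scoped ENNReal
open Literature.MathematicalPhysics.KineticTheory.PhononBoltzmann
open Summit.AtomisticToContinuum.FouriersLaw.Theorems.FGRGap.Negative.LoadBearing

namespace Summit.AtomisticToContinuum.FouriersLaw.Theorems.FGRGap.Negative.LogCoerciveLine

/-- The band is measurable (indeed continuous). [folklore] -/
theorem measurable_dispersion (ω₂ : ℝ) : Measurable (dispersion ω₂) := by
  have hc : Continuous (dispersion ω₂) := by unfold dispersion; fun_prop
  exact hc.measurable

/-- `‖ω‖² < ∞` on the cell (`ω² ≤ ω₂ + 4`). [folklore] -/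
theorem cellNormSq_dispersion_lt_top {ω₂ : ℝ} (hω : 0 ≤ ω₂) : cellNormSq (dispersion ω₂) < ∞ := by
  unfold cellNormSq
  have h1 : ∫⁻ k in Ioc (-π) π, ENNReal.ofReal (dispersion ω₂ k ^ 2) ≤
      ∫⁻ _ in Ioc (-π) π, ENNReal.ofReal (ω₂ + 4) := by
    apply setLIntegral_mono measurable_const
    intro k _
    apply ENNReal.ofReal_le_ofReal
    rw [dispersion_sq hω]
    have := Real.neg_one_le_cos k
    linarith
  rw [setLIntegral_const] at h1
  exact lt_of_le_of_lt h1 (ENNReal.mul_lt_top ENNReal.ofReal_lt_top (by simp))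

/-- `q(ω) = 0` (energy is a collisional invariant). [folklore] -/
theorem boltzmannForm_dispersion (ω₂ a b : ℝ) : boltzmannForm ω₂ a b (dispersion ω₂) = 0 := by
  have h := boltzmannForm_const_add_mul_dispersion ω₂ a b 0 1
  simp only [zero_add, one_mul] at h
  exact h

/-- The band is strictly increasing on `[0, π]` (`ω₂ ≥ 0`). [folklore] -/
theorem dispersion_lt_dispersion {ω₂ : ℝ} (hω : 0 ≤ ω₂) {x y : ℝ} (hx : 0 ≤ x) (hxy : x < y)
    (hy : y ≤ π) : dispersion ω₂ x < dispersion ω₂ y := by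
  unfold dispersion
  have hcos : Real.cos y < Real.cos x :=
    Real.strictAntiOn_cos ⟨hx, by linarith⟩ ⟨by linarith, hy⟩ hxy
  apply Real.sqrt_lt_sqrt
  · have := two_mul_one_sub_cos_nonneg x
    linarith
  · linarith

/-- **`G(ω) > 0`**: the energy invariant has positive log-Sobolev (Gagliardo) functional — the integrand
is positive on the box `k ∈ (0,1]`, `t ∈ (0,1)` by strict monotonicity of `ω` on `[0, π]`. [folklore] -/
theorem gagliardo_dispersion_pos {ω₂ : ℝ} (hω : 0 < ω₂) :
    0 < ∫⁻ k in Ioc (-π) π, ∫⁻ t in Ioo (-1 : ℝ) 1,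
      ENNReal.ofReal ((dispersion ω₂ (k + t) - dispersion ω₂ k) ^ 2 / |t|) := by
  set g : ℝ × ℝ → ℝ≥0∞ :=
    fun p => ENNReal.ofReal ((dispersion ω₂ (p.1 + p.2) - dispersion ω₂ p.1) ^ 2 / |p.2|) with hg
  have hmeas : Measurable g := by
    have hd := measurable_dispersion ω₂
    have h1 : Measurable fun p : ℝ × ℝ =>
        (dispersion ω₂ (p.1 + p.2) - dispersion ω₂ p.1) ^ 2 / |p.2| :=
      (((hd.comp (measurable_fst.add measurable_snd)).sub (hd.comp measurable_fst)).pow_const 2).div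
        (continuous_abs.measurable.comp measurable_snd)
    exact h1.ennreal_ofReal
  change 0 < ∫⁻ k in Ioc (-π) π, ∫⁻ t in Ioo (-1 : ℝ) 1, g (k, t)
  have hsubk : Ioc (0 : ℝ) 1 ⊆ Ioc (-π) π := fun k hk =>
    ⟨by linarith [hk.1, Real.pi_pos], by linarith [hk.2, Real.pi_gt_three]⟩
  have hsubt : Ioo (0 : ℝ) 1 ⊆ Ioo (-1) 1 := fun t ht => ⟨by linarith [ht.1], ht.2⟩
  have hle : ∫⁻ k in Ioc (0 : ℝ) 1, ∫⁻ t in Ioo (0 : ℝ) 1, g (k, t) ≤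
      ∫⁻ k in Ioc (-π) π, ∫⁻ t in Ioo (-1 : ℝ) 1, g (k, t) :=
    calc ∫⁻ k in Ioc (0 : ℝ) 1, ∫⁻ t in Ioo (0 : ℝ) 1, g (k, t)
        ≤ ∫⁻ k in Ioc (0 : ℝ) 1, ∫⁻ t in Ioo (-1 : ℝ) 1, g (k, t) :=
          lintegral_mono fun k => lintegral_mono_set hsubt
      _ ≤ _ := lintegral_mono_set hsubk
  refine lt_of_lt_of_le ?_ hle
  have hpos : ∀ k ∈ Ioc (0 : ℝ) 1, ∀ t ∈ Ioo (0 : ℝ) 1, 0 < g (k, t) := by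
    intro k hk t ht
    simp only [hg]
    rw [ENNReal.ofReal_pos]
    apply div_pos _ (abs_pos.mpr ht.1.ne')
    have hlt : dispersion ω₂ k < dispersion ω₂ (k + t) :=
      dispersion_lt_dispersion hω.le hk.1.le (by linarith [ht.1])
        (by linarith [hk.2, ht.2, Real.pi_gt_three])
    have : 0 < dispersion ω₂ (k + t) - dispersion ω₂ k := by linarith
    positivity
  have hF : Measurable fun k => ∫⁻ t in Ioo (0 : ℝ) 1, g (k, t) := hmeas.lintegral_prod_right'
  have hFpos : ∀ k ∈ Ioc (0 : ℝ) 1, 0 < ∫⁻ t in Ioo (0 : ℝ) 1, g (k, t) := by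
    intro k hk
    rw [pos_iff_ne_zero]
    intro h0
    have hm : Measurable fun t => g (k, t) := hmeas.comp measurable_prodMk_left
    rw [lintegral_eq_zero_iff hm] at h0
    have hae : ∀ᵐ t ∂(volume : Measure ℝ), t ∉ Ioo (0 : ℝ) 1 := by
      rw [Filter.EventuallyEq, ae_restrict_iff' measurableSet_Ioo] at h0
      filter_upwards [h0] with t ht htmem
      exact (hpos k hk t htmem).ne' (ht htmem)
    have hvol : volume (Ioo (0 : ℝ) 1) = 0 := measure_eq_zero_iff_ae_notMem.mpr hae
    simp at hvol
  rw [pos_iff_ne_zero]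
  intro h0
  rw [lintegral_eq_zero_iff hF] at h0
  have hae : ∀ᵐ k ∂(volume : Measure ℝ), k ∉ Ioc (0 : ℝ) 1 := by
    rw [Filter.EventuallyEq, ae_restrict_iff' measurableSet_Ioc] at h0
    filter_upwards [h0] with k hk hkmem
    exact (hFpos k hkmem).ne' (hk hkmem)
  have hvol : volume (Ioc (0 : ℝ) 1) = 0 := measure_eq_zero_iff_ae_notMem.mpr hae
  simp at hvol

/-- **The additive constant `C` of `LogCoerciveAt` is load-bearing.** For every `ω₂ > 0` and every
vertex `(a, b)`, the homogeneous inequality `c·G(f) ≤ q(f)` (the line's `LogCoerciveAt ω₂ a b` with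
`C = 0`, `G` unfolded) fails for all `c > 0`: witness the energy invariant `ω` (`q(ω) = 0 < G(ω)`). -/
theorem not_logCoercive_without_C {ω₂ : ℝ} (hω : 0 < ω₂) (a b : ℝ) :
    ¬ ∃ c : ℝ, 0 < c ∧ ∀ f : ℝ → ℝ, Function.Periodic f (2 * π) → Measurable f →
      cellNormSq f < ⊤ →
        ENNReal.ofReal c * (∫⁻ k in Ioc (-π) π, ∫⁻ t in Ioo (-1 : ℝ) 1,
          ENNReal.ofReal ((f (k + t) - f k) ^ 2 / |t|)) ≤ boltzmannForm ω₂ a b f := by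
  rintro ⟨c, hc, h⟩
  have H := h (dispersion ω₂) (dispersion_periodic ω₂) (measurable_dispersion ω₂)
    (cellNormSq_dispersion_lt_top hω.le)
  rw [boltzmannForm_dispersion] at H
  exact no_gap_of_null hc (gagliardo_dispersion_pos hω) rfl H

/-- **`Q_H(ω) = 0` for every a.e.-resonant partner map `H`** (the resonance clause of the line's
`IsGrazingBranch ω₂ t₀ H`): the bracket of `ω` along the branch is the resonance function,
`ω(k) + ω(H) - ω(k+t) - ω(H-t) = Ω(k, H, k+t) = 0`. [folklore] -/
theorem grazing_dispersion_eq_zero {ω₂ t₀ : ℝ} {H : ℝ → ℝ → ℝ}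
    (hres : ∀ᵐ p : ℝ × ℝ ∂(volume.restrict (Ioc (-π) π ×ˢ Ioo (-t₀) t₀)),
      H p.1 p.2 ∈ resonantSet ω₂ p.1 (p.1 + p.2)) :
    (∫⁻ k in Ioc (-π) π, ∫⁻ t in Ioo (-t₀) t₀,
      ENNReal.ofReal ((dispersion ω₂ k + dispersion ω₂ (H k t) - dispersion ω₂ (k + t) -
        dispersion ω₂ (H k t - t)) ^ 2 / |t|)) = 0 := by
  rw [Measure.volume_eq_prod, ← Measure.prod_restrict] at hres
  have h2 := Measure.ae_ae_of_ae_prod hres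
  have hinner : ∀ᵐ k ∂(volume.restrict (Ioc (-π) π)),
      (∫⁻ t in Ioo (-t₀) t₀, ENNReal.ofReal ((dispersion ω₂ k + dispersion ω₂ (H k t) -
        dispersion ω₂ (k + t) - dispersion ω₂ (H k t - t)) ^ 2 / |t|)) = 0 := by
    filter_upwards [h2] with k hk
    have hz : (fun t => ENNReal.ofReal ((dispersion ω₂ k + dispersion ω₂ (H k t) -
        dispersion ω₂ (k + t) - dispersion ω₂ (H k t - t)) ^ 2 / |t|))
          =ᵐ[volume.restrict (Ioo (-t₀) t₀)] fun _ => 0 := by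
      filter_upwards [hk] with t ht
      have hr := ht.2
      unfold resonanceFn at hr
      have e : k + H k t - (k + t) = H k t - t := by ring
      rw [e] at hr
      simp [hr]
    rw [lintegral_congr_ae hz, lintegral_zero]
  rw [lintegral_congr_ae hinner, lintegral_zero]

/-- **The additive constant `C` of STUB 2 (`stub_grazingDecorrelation`) is load-bearing.** For every
`ω₂ > 0`, every `t₀` and every a.e.-resonant partner map `H` on the strip, the homogeneous inequality
`c·G(f) ≤ Q_H(f)` (the stub's conclusion with `C = 0`, functionals unfolded) fails for all `c > 0`:
witness `ω` (`Q_H(ω) = 0 < G(ω)`). -/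
theorem no_grazingDecorrelation_without_C {ω₂ t₀ : ℝ} (hω : 0 < ω₂) {H : ℝ → ℝ → ℝ}
    (hres : ∀ᵐ p : ℝ × ℝ ∂(volume.restrict (Ioc (-π) π ×ˢ Ioo (-t₀) t₀)),
      H p.1 p.2 ∈ resonantSet ω₂ p.1 (p.1 + p.2)) :
    ¬ ∃ c : ℝ, 0 < c ∧ ∀ f : ℝ → ℝ, Function.Periodic f (2 * π) → Measurable f →
      cellNormSq f < ⊤ →
        ENNReal.ofReal c * (∫⁻ k in Ioc (-π) π, ∫⁻ t in Ioo (-1 : ℝ) 1,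
          ENNReal.ofReal ((f (k + t) - f k) ^ 2 / |t|)) ≤
          ∫⁻ k in Ioc (-π) π, ∫⁻ t in Ioo (-t₀) t₀,
            ENNReal.ofReal ((f k + f (H k t) - f (k + t) - f (H k t - t)) ^ 2 / |t|) := by
  rintro ⟨c, hc, h⟩
  have Hω := h (dispersion ω₂) (dispersion_periodic ω₂) (measurable_dispersion ω₂)
    (cellNormSq_dispersion_lt_top hω.le)
  rw [grazing_dispersion_eq_zero hres] at Hω
  exact no_gap_of_null hc (gagliardo_dispersion_pos hω) rfl Hω

/-! ### Quantitative inputs of STUB 1 on the grazing strip -/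

/-- Product-to-sum lower bound: `sin(x/2)·sin((x+t)/2) = (cos(t/2) - cos(x+t/2))/2 ≥ -t²/16`. [folklore] -/
theorem neg_sq_le_sin_half_mul_sin_half (x t : ℝ) :
    -(t ^ 2 / 16) ≤ Real.sin (x / 2) * Real.sin ((x + t) / 2) := by
  have h : Real.sin (x / 2) * Real.sin ((x + t) / 2) =
      (Real.cos (t / 2) - Real.cos (x + t / 2)) / 2 := by
    have h1 := Real.cos_sub (x / 2) ((x + t) / 2)
    have h2 := Real.cos_add (x / 2) ((x + t) / 2)
    have e1 : x / 2 - (x + t) / 2 = -(t / 2) := by ring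
    have e2 : x / 2 + (x + t) / 2 = x + t / 2 := by ring
    rw [e1, Real.cos_neg] at h1
    rw [e2] at h2
    linarith
  rw [h]
  have hc := Real.one_sub_sq_div_two_le_cos (x := t / 2)
  have hle := Real.cos_le_one (x + t / 2)
  nlinarith

/-- If `S₁, S₂ ≥ -c` (`c ≥ 0`) and `S₁, S₂ ≤ 1` then `S₁S₂ ≥ -c`. [folklore] -/
theorem neg_le_mul_of_bounds {S₁ S₂ c : ℝ} (hc : 0 ≤ c) (h1 : -c ≤ S₁) (h2 : -c ≤ S₂) (b1 : S₁ ≤ 1)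
    (b2 : S₂ ≤ 1) : -c ≤ S₁ * S₂ := by
  rcases le_or_gt 0 S₁ with p1 | n1 <;> rcases le_or_gt 0 S₂ with p2 | n2
  · nlinarith
  · nlinarith
  · nlinarith
  · nlinarith

/-- **Vertex lower bound on the grazing strip (input (iii) of STUB 1, no restriction on `k, H, t`)**:
for `b ≥ 0`, `Φ_{a,b}(k, H, k+t) ≥ a - b t²` — the form factor `∏ sin(k_j/2)` of the collision
`(k, H) → (k+t, H-t)` is `≥ -t²/16`. [folklore] -/
theorem vertex_ge_on_strip {a b : ℝ} (hb : 0 ≤ b) (k H t : ℝ) :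
    a - b * t ^ 2 ≤ vertex a b k H (k + t) := by
  unfold vertex
  have e : (k + H - (k + t)) / 2 = (H + -t) / 2 := by ring
  rw [e]
  have h1 := neg_sq_le_sin_half_mul_sin_half k t
  have h2 := neg_sq_le_sin_half_mul_sin_half H (-t)
  rw [neg_sq] at h2
  have b1 : Real.sin (k / 2) * Real.sin ((k + t) / 2) ≤ 1 := by
    have := Real.abs_sin_le_one (k / 2)
    have := Real.abs_sin_le_one ((k + t) / 2)
    nlinarith [abs_le.mp ‹|Real.sin (k / 2)| ≤ 1›, abs_le.mp ‹|Real.sin ((k + t) / 2)| ≤ 1›,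
      sq_nonneg (Real.sin (k / 2) - Real.sin ((k + t) / 2))]
  have b2 : Real.sin (H / 2) * Real.sin ((H + -t) / 2) ≤ 1 := by
    have := Real.abs_sin_le_one (H / 2)
    have := Real.abs_sin_le_one ((H + -t) / 2)
    nlinarith [abs_le.mp ‹|Real.sin (H / 2)| ≤ 1›, abs_le.mp ‹|Real.sin ((H + -t) / 2)| ≤ 1›,
      sq_nonneg (Real.sin (H / 2) - Real.sin ((H + -t) / 2))]
  have hp := neg_le_mul_of_bounds (by positivity) h1 h2 b1 b2
  have hprod : Real.sin (k / 2) * Real.sin (H / 2) * Real.sin ((k + t) / 2) * Real.sin ((H + -t) / 2) =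
      (Real.sin (k / 2) * Real.sin ((k + t) / 2)) * (Real.sin (H / 2) * Real.sin ((H + -t) / 2)) := by ring
  rw [hprod]
  have := mul_nonneg hb (by linarith [hp] :
    0 ≤ (Real.sin (k / 2) * Real.sin ((k + t) / 2)) * (Real.sin (H / 2) * Real.sin ((H + -t) / 2)) + t ^ 2 / 16)
  nlinarith

/-- The group velocity is differentiable with the quotient-rule derivative (`ω₂ > 0`). [folklore] -/
theorem hasDerivAt_groupVelocity {ω₂ : ℝ} (hω : 0 < ω₂) (k : ℝ) :
    HasDerivAt (groupVelocity ω₂)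
      ((Real.cos k * dispersion ω₂ k - Real.sin k * groupVelocity ω₂ k) / dispersion ω₂ k ^ 2) k := by
  have h := (Real.hasDerivAt_sin k).div (hasDerivAt_dispersion hω k) (dispersion_pos hω k).ne'
  exact h

/-- The Lipschitz constant of the group velocity used below: `L(ω₂) = 1/√ω₂ + 1/√ω₂³`. -/
def velLip (ω₂ : ℝ) : ℝ := 1 / Real.sqrt ω₂ + 1 / Real.sqrt ω₂ ^ 3

/-- `0 < L(ω₂)` for `ω₂ > 0`. [folklore] -/
theorem velLip_pos {ω₂ : ℝ} (hω : 0 < ω₂) : 0 < velLip ω₂ := by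
  unfold velLip
  have := Real.sqrt_pos.mpr hω
  positivity

/-- `|ω''| ≤ L(ω₂)`: the quotient-rule derivative of `sin/ω` is bounded by `1/ω + 1/ω³ ≤ 1/√ω₂ + 1/√ω₂³`. -/
theorem abs_deriv_groupVelocity_le {ω₂ : ℝ} (hω : 0 < ω₂) (k : ℝ) :
    |(Real.cos k * dispersion ω₂ k - Real.sin k * groupVelocity ω₂ k) / dispersion ω₂ k ^ 2| ≤ velLip ω₂ := by
  have hωk : 0 < dispersion ω₂ k := dispersion_pos hω k
  have hs : 0 < Real.sqrt ω₂ := Real.sqrt_pos.mpr hω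
  have hsk : Real.sqrt ω₂ ≤ dispersion ω₂ k := sqrt_le_dispersion k
  set w := dispersion ω₂ k with hw
  have hgv : groupVelocity ω₂ k = Real.sin k / w := rfl
  rw [hgv, abs_div, abs_of_pos (by positivity : 0 < w ^ 2)]
  -- numerator bound: |cos k · w - sin k · (sin k / w)| ≤ w + 1/w
  have hnum : |Real.cos k * w - Real.sin k * (Real.sin k / w)| ≤ w + 1 / w := by
    have hc := Real.abs_cos_le_one k
    have hsn := Real.abs_sin_le_one k
    have e : Real.sin k * (Real.sin k / w) = Real.sin k ^ 2 / w := by ring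
    rw [e]
    calc |Real.cos k * w - Real.sin k ^ 2 / w| ≤ |Real.cos k * w| + |Real.sin k ^ 2 / w| := abs_sub _ _
      _ ≤ w + 1 / w := by
        apply add_le_add
        · rw [abs_mul, abs_of_pos hωk]
          nlinarith
        · rw [abs_div, abs_of_pos hωk, abs_of_nonneg (sq_nonneg _)]
          apply div_le_div_of_nonneg_right _ hωk.le
          nlinarith [Real.sin_sq_le_one k]
  calc |Real.cos k * w - Real.sin k * (Real.sin k / w)| / w ^ 2 ≤ (w + 1 / w) / w ^ 2 :=
        div_le_div_of_nonneg_right hnum (by positivity)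
    _ = 1 / w + 1 / w ^ 3 := by field_simp
    _ ≤ velLip ω₂ := by
        unfold velLip
        apply add_le_add
        · exact one_div_le_one_div_of_le hs hsk
        · apply one_div_le_one_div_of_le (by positivity)
          exact pow_le_pow_left₀ hs.le hsk 3

/-- **The group velocity is `L(ω₂)`-Lipschitz** (mean value theorem). [folklore] -/
theorem abs_groupVelocity_sub_le {ω₂ : ℝ} (hω : 0 < ω₂) (x y : ℝ) :
    |groupVelocity ω₂ x - groupVelocity ω₂ y| ≤ velLip ω₂ * |x - y| := by
  have h := Convex.norm_image_sub_le_of_norm_hasDerivWithin_le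
    (f := groupVelocity ω₂) (s := Set.univ)
    (fun z _ => (hasDerivAt_groupVelocity hω z).hasDerivWithinAt)
    (fun z _ => by rw [Real.norm_eq_abs]; exact abs_deriv_groupVelocity_le hω z)
    convex_univ (Set.mem_univ y) (Set.mem_univ x)
  simpa [Real.norm_eq_abs] using h

/-- **Jacobian bound on the grazing strip (input (ii) of STUB 1, for EVERY partner `k₂`)**:
`|∂₂Ω(k₁,k₂,k₃)| = |ω'(k₂) - ω'(k₁+k₂-k₃)| ≤ L(ω₂)·|k₃ - k₁|` — no geometry of the branch is needed. -/
theorem resonanceJacobian_le {ω₂ : ℝ} (hω : 0 < ω₂) (k₁ k₂ k₃ : ℝ) :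
    resonanceJacobian ω₂ k₁ k₂ k₃ ≤ velLip ω₂ * |k₃ - k₁| := by
  unfold resonanceJacobian
  have h := abs_groupVelocity_sub_le hω k₂ (k₁ + k₂ - k₃)
  have e : k₂ - (k₁ + k₂ - k₃) = k₃ - k₁ := by ring
  rwa [e] at h

/-- `(ω₁ω₂ω₃ω₄)² ≤ (ω₂+4)⁴`. [folklore] -/
theorem prod_dispersion_sq_le {ω₂ : ℝ} (hω : 0 ≤ ω₂) (k₁ k₂ k₃ k₄ : ℝ) :
    (dispersion ω₂ k₁ * dispersion ω₂ k₂ * dispersion ω₂ k₃ * dispersion ω₂ k₄) ^ 2 ≤ (ω₂ + 4) ^ 4 := by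
  have hb : ∀ k, dispersion ω₂ k ^ 2 ≤ ω₂ + 4 := fun k => by
    rw [dispersion_sq hω]; have := Real.neg_one_le_cos k; linarith
  have hn : ∀ k, 0 ≤ dispersion ω₂ k ^ 2 := fun k => sq_nonneg _
  have e : (dispersion ω₂ k₁ * dispersion ω₂ k₂ * dispersion ω₂ k₃ * dispersion ω₂ k₄) ^ 2 =
      dispersion ω₂ k₁ ^ 2 * dispersion ω₂ k₂ ^ 2 * dispersion ω₂ k₃ ^ 2 * dispersion ω₂ k₄ ^ 2 := by ring
  rw [e]
  have e4 : (ω₂ + 4) ^ 4 = (ω₂ + 4) * (ω₂ + 4) * (ω₂ + 4) * (ω₂ + 4) := by ring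
  rw [e4]
  have h12 := mul_le_mul (hb k₁) (hb k₂) (hn k₂) (by linarith [hn k₁, hb k₁])
  have h123 := mul_le_mul h12 (hb k₃) (hn k₃) (by positivity)
  exact mul_le_mul h123 (hb k₄) (hn k₄) (by positivity)

/-- **Collision-weight lower bound on the grazing strip (inputs (ii)+(iii) of STUB 1 combined)**: for
`ω₂ > 0`, `b ≥ 0`, `b t² ≤ a/2` and a partner `H` at which the Jacobian does not vanish,
`w(k, H, k+t) ≥ (9/16π)·(a/2)²·(ω₂+4)⁻⁴ / (L(ω₂)|t|)`.  Valid for EVERY real `k, H, t` — the only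
branch-specific input left for STUB 1 is that `H(k,t)` is resonant, non-trivial and a.e. unique. -/
theorem collisionWeight_ge_on_strip {ω₂ a b : ℝ} (hω : 0 < ω₂) (hb : 0 ≤ b) {k H t : ℝ}
    (hat : b * t ^ 2 ≤ a / 2) (hJ : resonanceJacobian ω₂ k H (k + t) ≠ 0) :
    alsPrefactor * (a / 2) ^ 2 / (ω₂ + 4) ^ 4 / (velLip ω₂ * |t|) ≤ collisionWeight ω₂ a b k H (k + t) := by
  unfold collisionWeight
  have hpref := alsPrefactor_pos
  have hJpos : 0 < resonanceJacobian ω₂ k H (k + t) :=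
    lt_of_le_of_ne (by unfold resonanceJacobian; positivity) (Ne.symm hJ)
  have hJle : resonanceJacobian ω₂ k H (k + t) ≤ velLip ω₂ * |t| := by
    have h := resonanceJacobian_le hω k H (k + t)
    have e : k + t - k = t := by ring
    rwa [e] at h
  have hLt : 0 < velLip ω₂ * |t| := lt_of_lt_of_le hJpos hJle
  have ha2 : 0 ≤ a / 2 := by nlinarith [sq_nonneg t]
  have hΦ : (a / 2) ^ 2 ≤ vertex a b k H (k + t) ^ 2 := by
    have hv := vertex_ge_on_strip hb k H t (a := a)
    exact pow_le_pow_left₀ ha2 (by linarith) 2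
  have hP : (dispersion ω₂ k * dispersion ω₂ H * dispersion ω₂ (k + t) * dispersion ω₂ (k + H - (k + t))) ^ 2 ≤
      (ω₂ + 4) ^ 4 := prod_dispersion_sq_le hω.le _ _ _ _
  have hPpos : 0 < (dispersion ω₂ k * dispersion ω₂ H * dispersion ω₂ (k + t) *
      dispersion ω₂ (k + H - (k + t))) ^ 2 := by
    have := dispersion_pos hω k; have := dispersion_pos hω H; have := dispersion_pos hω (k + t)
    have := dispersion_pos hω (k + H - (k + t))
    positivity
  -- chain the four monotone steps
  calc alsPrefactor * (a / 2) ^ 2 / (ω₂ + 4) ^ 4 / (velLip ω₂ * |t|)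
      ≤ alsPrefactor * vertex a b k H (k + t) ^ 2 / (ω₂ + 4) ^ 4 / (velLip ω₂ * |t|) := by
        gcongr
    _ ≤ alsPrefactor * vertex a b k H (k + t) ^ 2 /
          (dispersion ω₂ k * dispersion ω₂ H * dispersion ω₂ (k + t) * dispersion ω₂ (k + H - (k + t))) ^ 2 /
          (velLip ω₂ * |t|) := by
        gcongr
    _ ≤ _ := by
        gcongr


end Summit.AtomisticToContinuum.FouriersLaw.Theorems.FGRGap.Negative.LogCoerciveLine

end
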